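import Summits.Ventures.CertifiedManyBodySolver.Rows.FluxTorusGaugeAut
import Literature.MathematicalPhysics.QuantumLattice.MagneticHubbardTorusGauge
import Summits.HubbardSuperconductivity.ManyBodyBootstrap.HubbardTorusCommutatorSharp
import HarnessLib

/-!
# Flux-torus ceiling III — the window gauge: tiling identity, EOM rows, translation rows

HONEST FRAMING: first certified bounds; not a superconductivity verdict; every number certified or
labelled float. Part 3 of the kernel transport of window certificates to the flux sectors of the
Hubbard torus (`Rows/TorusCeilingFlux.lean`): the window gauge `ĝ(x mod L) = e^{iθx₁/L}` on the
image of the window `Λ'` (`windowTwist`), the tiling identity "the translates of the ĝ-twisted local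
energy sum to `H_u`", the triviality of the ĝ-transformed uniform field on every image bond, and
the transported rows: in the window gauge the defect `H_{ĝ·A_u·ĝ⁻¹} − hubbardTorus` is supported off
the image of the inner region `Λ`, so EOM rows `[h_{Λ'}, Γ B]` transport to `[H_u, Ad(W_ĝ) Γ(ι) B]`
through pub-mbboot's sharp periodic commutator lemma `hubbardTorus_commutator_fermionEmbed_sharp`,
and translation rows transport to symmetry defects of the magnetic translations
`T_{v mod L} e^{iθv₁N̂/L}`. [cite: Lieb1994, eq. (1)] [cite: BratteliRobinsonII1997, §5.2.2]
[cite: Han2020Bootstrap, §3]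
-/

noncomputable section

open Matrix Finset
open Literature.MathematicalPhysics.QuantumLattice
open Literature.MathematicalPhysics.QuantumFieldTheory hiding Site
open Literature.MathematicalPhysics.QuantumManyBody.StateRelaxation
open Literature.Probability.LatticeModels
open HubbardWave0
open scoped ComplexOrder ComplexConjugate

namespace Summit.Ventures.CertifiedManyBodySolver.Rows

/-! ### §4. The window gauge `ĝ = e^{iθx₁/L}` on the image of the window, and the transported rows -/

section Window

variable {L : ℕ} [NeZero L]

-- No `local instance` here: the theorems whose statements involve torus operators take the
-- `DecidableEq (FermionTorus 2 L)` instance as a binder and fix it to the order-derived one (the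
-- convention of the tree's torus files) inside the proof, so that callers may use any instance.
/-- The **window gauge** on torus sites: `ĝ(x mod L) = e^{iθ x₁/L}` for `x ∈ Λ'` (well defined when
`x ↦ x mod L` is injective on `Λ'`), `ĝ = 1` off the image of `Λ'`. Written choice-free as a product
over the (`≤ 1`-element) fibre. -/
def windowTwist (L : ℕ) [NeZero L] (θ : ℝ) (Λ' : Finset (Site 2)) (s : TorusSite 2 L) : Circle :=
  ∏ x ∈ Λ'.filter (fun x => Torus.proj L x = s), Circle.exp (θ / L * (x 0 : ℝ))

/-- The window gauge at an image point: `ĝ(x mod L) = e^{iθx₁/L}`, `x ∈ Λ'`. [folklore] -/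
theorem windowTwist_proj (θ : ℝ) {Λ' : Finset (Site 2)} (hInj' : Set.InjOn (Torus.proj (d := 2) L) ↑Λ')
    {x : Site 2} (hx : x ∈ Λ') :
    windowTwist L θ Λ' (Torus.proj L x) = Circle.exp (θ / L * (x 0 : ℝ)) := by
  unfold windowTwist
  have hfilter : Λ'.filter (fun y => Torus.proj L y = Torus.proj L x) = {x} := by
    ext y
    simp only [Finset.mem_filter, Finset.mem_singleton]
    constructor
    · rintro ⟨hy, he⟩; exact hInj' hy hx he
    · rintro rfl; exact ⟨hx, rfl⟩
  rw [hfilter, Finset.prod_singleton]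

/-- The window gauge read through a torus embedding of a sub-window. -/
theorem windowTwist_toTorusEmb (θ : ℝ) {S Λ' : Finset (Site 2)} (hS : S ⊆ Λ')
    (hInj' : Set.InjOn (Torus.proj (d := 2) L) ↑Λ') (y : PolySite S) :
    windowTwist L θ Λ' ((PolySite.toTorusEmb L (hInj'.mono (by exact_mod_cast hS)) y).toTorusSite) =
      Circle.exp (θ / L * ((ofLex y.1) 0 : ℝ)) := by
  rw [PolySite.toTorusEmb_apply, FermionTorus.toTorusSite_ofTorusSite]
  exact windowTwist_proj θ hInj' (hS (PolySite.ofLex_mem y))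

omit [NeZero L] in
/-- `x ↦ x mod L` is additive. [folklore] -/
theorem proj_add (x y : Site 2) : Torus.proj L (x + y) = Torus.proj L x + Torus.proj L y := by
  funext i; simp [Torus.proj]
/-- **The twisted local energy tiles the uniformly twisted torus.** The translates of
`W_ĝ Γ(ι₀)(E_Φ) W_ĝᴴ` — the symmetric mean energy at the origin with the phases `e^{∓iθ/L}` on its
horizontal hopping terms (`ĝ(0) = 1`, `ĝ(±e₁) = e^{±iθ/L}`, `ĝ(±e₂) = 1`) — sum to
`magneticHubbardTorus L (uniformTwistConfig L θ) 1 U` (every bond is counted from both endpoints with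
weight `½`). Bratteli–Robinson II §6.2.4; Lieb 1994 eq. (1). [folklore] -/
theorem sum_fockTranslate_gaugeAut_meanEnergyObs [DecidableEq (FermionTorus 2 L)] (U θ : ℝ) {Λ' : Finset (Site 2)}
    (h0 : thicken ({0} : Finset (Site 2)) 1 ⊆ Λ') (hInj' : Set.InjOn (Torus.proj (d := 2) L) ↑Λ') :
    ∑ v : TorusSite 2 L, (fockTranslate v).val *
        gaugeAut (fun u : FermionTorus 2 L => windowTwist L θ Λ' u.toTorusSite)
          (fermionEmbed (PolySite.toTorusEmb L hInj')
            (fermionEmbed (PolySite.incl h0) ((hubbardFermionInteraction 2 1 U).meanEnergyObs 1))) *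
        (fockTranslate v).valᴴ =
      magneticHubbardTorus L (uniformTwistConfig L θ) 1 U := by
  obtain rfl : ‹DecidableEq (FermionTorus 2 L)› = LinearOrder.toDecidableEq := Subsingleton.elim _ _
  letI instDE' : DecidableEq (FermionTorus 2 L) := LinearOrder.toDecidableEq
  set ĝ : FermionTorus 2 L → Circle := fun u => windowTwist L θ Λ' u.toTorusSite with hĝ
  have hInj0 : Set.InjOn (Torus.proj (d := 2) L) ↑(thicken ({0} : Finset (Site 2)) 1) :=
    hInj'.mono (by exact_mod_cast h0)
  -- abbreviations for the torus operators
  set o : TorusSite 2 L → FermionTorus 2 L := FermionTorus.ofTorusSite with ho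
  set cd : TorusSite 2 L → Fin 2 → Matrix (Finset (Orb (FermionTorus 2 L))) (Finset (Orb (FermionTorus 2 L))) ℂ :=
    fun x σ => creation (orb (o x) σ) with hcd
  set c : TorusSite 2 L → Fin 2 → Matrix (Finset (Orb (FermionTorus 2 L))) (Finset (Orb (FermionTorus 2 L))) ℂ :=
    fun x σ => annihilation (orb (o x) σ) with hc
  set nn : TorusSite 2 L → Matrix (Finset (Orb (FermionTorus 2 L))) (Finset (Orb (FermionTorus 2 L))) ℂ :=
    fun x => numberOp (o x) 0 * numberOp (o x) 1 with hnn
  set u : Fin 2 → Circle := fun i => if i = 0 then Circle.exp (θ / L) else 1 with hu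
  -- the window gauge at `0`, `±eᵢ`
  have hproj0 : Torus.proj L (0 : Site 2) = 0 := by funext j; simp [Torus.proj]
  have hg0 : (ĝ (FermionTorus.ofTorusSite (0 : TorusSite 2 L)) : ℂ) = 1 := by
    rw [hĝ]; dsimp only
    rw [FermionTorus.toTorusSite_ofTorusSite, ← hproj0, windowTwist_proj θ hInj' (h0 (zero_mem_thicken_zero 1))]
    simp
  have hgp : ∀ i : Fin 2, (ĝ (FermionTorus.ofTorusSite (Pi.single i 1 : TorusSite 2 L)) : ℂ) = (u i : ℂ) := by
    intro i
    rw [hĝ]; dsimp only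
    rw [FermionTorus.toTorusSite_ofTorusSite, ← proj_unitVec L i,
      windowTwist_proj θ hInj' (h0 (unitVec_mem_thicken_one i))]
    fin_cases i <;> simp [unitVec, hu]
  have hgm : ∀ i : Fin 2, (ĝ (FermionTorus.ofTorusSite (-Pi.single i 1 : TorusSite 2 L)) : ℂ) =
      conj (u i : ℂ) := by
    intro i
    rw [hĝ]; dsimp only
    rw [FermionTorus.toTorusSite_ofTorusSite, ← proj_neg_unitVec L i,
      windowTwist_proj θ hInj' (h0 (neg_unitVec_mem_thicken_one i)), ← Circle.coe_inv_eq_conj]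
    fin_cases i <;> simp [unitVec, hu, ← Circle.exp_neg]
  -- the translate by `v` of the twisted local energy
  have hcomm : ∀ (w : TorusSite 2 L) (i : Fin 2), (Pi.single i 1 : TorusSite 2 L) + w = w + Pi.single i 1 :=
    fun w i => add_comm _ _
  have htrans : ∀ v : TorusSite 2 L, (fockTranslate v).val *
      gaugeAut ĝ (fermionEmbed (PolySite.toTorusEmb L hInj')
        (fermionEmbed (PolySite.incl h0) ((hubbardFermionInteraction 2 1 U).meanEnergyObs 1))) *
      (fockTranslate v).valᴴ =
      (U : ℂ) • nn v + ∑ i : Fin 2, ((2 : ℂ)⁻¹ * -((1 : ℝ) : ℂ)) • ∑ σ : Fin 2,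
        ((conj (u i : ℂ) • (cd v σ * c (v + Pi.single i 1) σ) + (u i : ℂ) • (cd (v + Pi.single i 1) σ * c v σ)) +
          (conj (u i : ℂ) • (cd (v - Pi.single i 1) σ * c v σ) + (u i : ℂ) • (cd v σ * c (v - Pi.single i 1) σ))) := by
    intro v
    rw [← relabel_eq_fockRelabel_conj, fermionEmbed_toTorusEmb_incl h0 hInj',
      fermionEmbed_toTorusEmb_hubbard_meanEnergyObs 1 U hInj0]
    simp only [map_add, map_smul, map_sum, map_mul, gaugeAut_creation_orb, gaugeAut_annihilation_orb,
      gaugeAut_numberOp, hg0, hgp, hgm, map_one, one_smul, Complex.conj_conj,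
      relabel_translate_creation, relabel_translate_annihilation, relabel_translate_numberOp, zero_add,
      neg_add_eq_sub, hcomm, smul_mul_assoc, mul_smul_comm]
    rfl
  simp_rw [htrans]
  rw [Finset.sum_add_distrib, ← Finset.smul_sum, Finset.sum_comm]
  -- the Hamiltonian, with all sums over `TorusSite`
  have hA : ∀ (x : TorusSite 2 L) (i : Fin 2), uniformTwistConfig L θ (x, i) = u i := fun _ _ => rfl
  have hsh : ∀ (x : TorusSite 2 L) (i : Fin 2),
      Literature.MathematicalPhysics.QuantumFieldTheory.Site.shift x i = x + Pi.single i 1 := fun _ _ => rfl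
  have hH : magneticHubbardTorus L (uniformTwistConfig L θ) 1 U =
      -((1 : ℝ) : ℂ) • (∑ x : TorusSite 2 L, ∑ i : Fin 2, ∑ σ : Fin 2,
        ((u i : ℂ) • (cd (x + Pi.single i 1) σ * c x σ) + conj (u i : ℂ) • (cd x σ * c (x + Pi.single i 1) σ))) +
        (U : ℂ) • ∑ x : TorusSite 2 L, nn x := by
    rw [magneticHubbardTorus_eq]
    simp only [hA, hsh]
    congr 1
    congr 1
    exact (Fintype.sum_equiv FermionTorus.equivTorusSite.symm (fun v => nn v)
      (fun x : FermionTorus 2 L => numberOp x 0 * numberOp x 1) fun v => rfl).symm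
  rw [hH, add_comm]
  congr 1
  -- the hopping part: each bond is counted twice with weight `½`
  simp only [Finset.smul_sum]
  conv_rhs => rw [Finset.sum_comm]
  refine Finset.sum_congr rfl fun i _ => ?_
  have hshift1 : ∑ v : TorusSite 2 L, ∑ σ : Fin 2, ((2 : ℂ)⁻¹ * -((1 : ℝ) : ℂ)) •
      (conj (u i : ℂ) • (cd (v - Pi.single i 1) σ * c v σ)) =
      ∑ v : TorusSite 2 L, ∑ σ : Fin 2, ((2 : ℂ)⁻¹ * -((1 : ℝ) : ℂ)) •
        (conj (u i : ℂ) • (cd v σ * c (v + Pi.single i 1) σ)) :=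
    TorusSite.sum_sub_shift (Pi.single i 1)
      (fun a b => ∑ σ : Fin 2, ((2 : ℂ)⁻¹ * -((1 : ℝ) : ℂ)) • (conj (u i : ℂ) • (cd b σ * c a σ)))
  have hshift2 : ∑ v : TorusSite 2 L, ∑ σ : Fin 2, ((2 : ℂ)⁻¹ * -((1 : ℝ) : ℂ)) •
      ((u i : ℂ) • (cd v σ * c (v - Pi.single i 1) σ)) =
      ∑ v : TorusSite 2 L, ∑ σ : Fin 2, ((2 : ℂ)⁻¹ * -((1 : ℝ) : ℂ)) •
        ((u i : ℂ) • (cd (v + Pi.single i 1) σ * c v σ)) :=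
    TorusSite.sum_sub_shift (Pi.single i 1)
      (fun a b => ∑ σ : Fin 2, ((2 : ℂ)⁻¹ * -((1 : ℝ) : ℂ)) • ((u i : ℂ) • (cd a σ * c b σ)))
  simp only [smul_add, Finset.sum_add_distrib]
  rw [hshift1, hshift2]
  have ha : ∀ z : ℂ, -((1 : ℝ) : ℂ) * z = (2 : ℂ)⁻¹ * -((1 : ℝ) : ℂ) * z + (2 : ℂ)⁻¹ * -((1 : ℝ) : ℂ) * z :=
    fun z => by ring
  simp only [smul_smul, ← Finset.smul_sum]
  rw [ha, ha, add_smul, add_smul]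
  abel

/-- **In the window gauge the field is trivial on every image bond.** For a torus bond
`(x, x + eᵢ)` with an endpoint in `ι(Λ)`, both endpoints are images of window points (`Λ'` contains
the neighbours of `Λ`), and `ĝ(x) e^{iθ[i=0]/L} ĝ(x+eᵢ)⁻¹ = 1`. -/
theorem gaugeTransform_windowTwist_eq_one (θ : ℝ) {Λ Λ' : Finset (Site 2)} (hΛ : Λ ⊆ Λ')
    (hclosed : ∀ x ∈ Λ, ∀ i : Fin 2, x + unitVec i ∈ Λ' ∧ x - unitVec i ∈ Λ')
    (hInj' : Set.InjOn (Torus.proj (d := 2) L) ↑Λ') (x : TorusSite 2 L) (i : Fin 2)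
    (h : (∃ z ∈ Λ, x = Torus.proj L z) ∨
      (∃ z ∈ Λ, Literature.MathematicalPhysics.QuantumFieldTheory.Site.shift x i = Torus.proj L z)) :
    gaugeTransform (windowTwist L θ Λ') (uniformTwistConfig L θ) (x, i) = 1 := by
  have proj_sub : ∀ a b : Site 2, Torus.proj L (a - b) = Torus.proj L a - Torus.proj L b := fun a b => by
    funext j; simp [Torus.proj]
  -- both endpoints are images of window points `z₀, z₀ + eᵢ ∈ Λ'`
  obtain ⟨z₀, hz₀, hz₁, hx⟩ : ∃ z₀ : Site 2, z₀ ∈ Λ' ∧ z₀ + unitVec i ∈ Λ' ∧ x = Torus.proj L z₀ := by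
    rcases h with ⟨z, hz, hx'⟩ | ⟨z, hz, hx'⟩
    · exact ⟨z, hΛ hz, (hclosed z hz i).1, hx'⟩
    · refine ⟨z - unitVec i, (hclosed z hz i).2, by rw [sub_add_cancel]; exact hΛ hz, ?_⟩
      rw [proj_sub, proj_unitVec, ← hx']
      simp [Literature.MathematicalPhysics.QuantumFieldTheory.Site.shift]
  have hshift : Literature.MathematicalPhysics.QuantumFieldTheory.Site.shift x i = Torus.proj L (z₀ + unitVec i) := by
    rw [proj_add, proj_unitVec, hx]; rfl
  simp only [gaugeTransform]
  rw [hshift, hx, windowTwist_proj θ hInj' hz₀, windowTwist_proj θ hInj' hz₁]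
  fin_cases i
  · simp only [uniformTwistConfig, Fin.zero_eta, Fin.isValue, ↓reduceIte]
    rw [← Circle.exp_add, ← Circle.exp_neg, ← Circle.exp_add, ← Circle.exp_zero]
    congr 1
    simp [unitVec]
    ring
  · simp only [uniformTwistConfig, Fin.mk_one, Fin.isValue, one_ne_zero, ↓reduceIte, mul_one]
    rw [← Circle.exp_neg, ← Circle.exp_add, ← Circle.exp_zero]
    congr 1
    simp [unitVec]

/-- **The non-image defect is far from `ι(Λ)`.** `H_{ĝ·A_u·ĝ⁻¹} − H_{A ≡ 1}` is a sum of hopping terms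
over bonds where the window-gauged field is non-trivial, hence (previous lemma) over bonds avoiding
`ι(Λ)`: it lies in the even CAR algebra of the complement of `orbs ι(Λ)`.
[cite: BratteliRobinsonII1997, §5.2.2] -/
theorem magneticHubbardTorus_windowGauge_sub_hubbardTorus_mem [DecidableEq (FermionTorus 2 L)] (hL : 3 ≤ L) (U θ : ℝ)
    {Λ Λ' : Finset (Site 2)} (hΛ : Λ ⊆ Λ')
    (hclosed : ∀ x ∈ Λ, ∀ i : Fin 2, x + unitVec i ∈ Λ' ∧ x - unitVec i ∈ Λ')
    (hInj' : Set.InjOn (Torus.proj (d := 2) L) ↑Λ') :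
    magneticHubbardTorus L (gaugeTransform (windowTwist L θ Λ') (uniformTwistConfig L θ)) 1 U -
        hubbardTorus 2 L 1 U ∈
      carEvenSubalgebra (orbs ((Finset.univ : Finset (PolySite Λ)).map
        ((PolySite.incl hΛ).trans (PolySite.toTorusEmb L hInj'))))ᶜ := by
  obtain rfl : ‹DecidableEq (FermionTorus 2 L)› = LinearOrder.toDecidableEq := Subsingleton.elim _ _
  letI instDE' : DecidableEq (FermionTorus 2 L) := LinearOrder.toDecidableEq
  set ι' := (PolySite.incl hΛ).trans (PolySite.toTorusEmb L hInj') with hι'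
  -- orbitals at torus sites that are not images of `Λ` lie in the complement
  have hmem : ∀ y : TorusSite 2 L, (∀ z ∈ Λ, y ≠ Torus.proj L z) → ∀ τ : Fin 2,
      orb (FermionTorus.ofTorusSite y) τ ∈ (orbs ((Finset.univ : Finset (PolySite Λ)).map ι'))ᶜ := by
    intro y hy τ
    refine Finset.mem_compl.2 fun h' => ?_
    obtain ⟨p, -, hp⟩ := Finset.mem_map.1 (orb_mem_orbs.1 h')
    refine hy (ofLex p.1) (PolySite.ofLex_mem p) ?_
    have := congrArg FermionTorus.toTorusSite hp
    simpa [hι'] using this.symm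
  set A' := gaugeTransform (windowTwist L θ Λ') (uniformTwistConfig L θ) with hA'
  rw [← magneticHubbardTorus_one_eq_hubbardTorus hL 1 U, magneticHubbardTorus_eq, magneticHubbardTorus_eq,
    add_sub_add_right_eq_sub, ← smul_sub]
  refine SMulMemClass.smul_mem _ ?_
  rw [← Finset.sum_sub_distrib]
  refine sum_mem fun x _ => ?_
  rw [← Finset.sum_sub_distrib]
  refine sum_mem fun i _ => ?_
  rw [← Finset.sum_sub_distrib]
  refine sum_mem fun σ _ => ?_
  by_cases h : (∃ z ∈ Λ, x = Torus.proj L z) ∨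
      (∃ z ∈ Λ, Literature.MathematicalPhysics.QuantumFieldTheory.Site.shift x i = Torus.proj L z)
  · have h1 : A' (x, i) = 1 := gaugeTransform_windowTwist_eq_one θ hΛ hclosed hInj' x i h
    rw [h1, Pi.one_apply, sub_self]
    exact zero_mem _
  · push Not at h
    have hxS : ∀ τ : Fin 2, orb (FermionTorus.ofTorusSite x) τ ∈
        (orbs ((Finset.univ : Finset (PolySite Λ)).map ι'))ᶜ := hmem x h.1
    have hyS : ∀ τ : Fin 2, orb (FermionTorus.ofTorusSite
        (Literature.MathematicalPhysics.QuantumFieldTheory.Site.shift x i)) τ ∈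
        (orbs ((Finset.univ : Finset (PolySite Λ)).map ι'))ᶜ := hmem _ h.2
    refine sub_mem (add_mem (SMulMemClass.smul_mem _ ?_) (SMulMemClass.smul_mem _ ?_))
      (add_mem (SMulMemClass.smul_mem _ ?_) (SMulMemClass.smul_mem _ ?_))
    · exact creation_mul_annihilation_mem_carEvenSubalgebra (hyS σ) (hxS σ)
    · exact creation_mul_annihilation_mem_carEvenSubalgebra (hxS σ) (hyS σ)
    · exact creation_mul_annihilation_mem_carEvenSubalgebra (hyS σ) (hxS σ)
    · exact creation_mul_annihilation_mem_carEvenSubalgebra (hxS σ) (hyS σ)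

/-- The non-image defect `H_{A'} − H` commutes with every window observable of `Λ` (even, and
supported off `ι(Λ)`); the pattern of pub-mbboot's
`commute_hubbardTorus_sub_fermionEmbed_localHamiltonian_sharp`. -/
theorem commute_windowGaugeDefect_fermionEmbed [DecidableEq (FermionTorus 2 L)] (hL : 3 ≤ L) (U θ : ℝ)
    {Λ Λ' : Finset (Site 2)} (hΛ : Λ ⊆ Λ')
    (hclosed : ∀ x ∈ Λ, ∀ i : Fin 2, x + unitVec i ∈ Λ' ∧ x - unitVec i ∈ Λ')
    (hInj' : Set.InjOn (Torus.proj (d := 2) L) ↑Λ') (B : FermionOp Λ) :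
    Commute (magneticHubbardTorus L (gaugeTransform (windowTwist L θ Λ') (uniformTwistConfig L θ)) 1 U -
        hubbardTorus 2 L 1 U)
      (fermionEmbed (PolySite.toTorusEmb L hInj') (fermionEmbed (PolySite.incl hΛ) B)) := by
  obtain rfl : ‹DecidableEq (FermionTorus 2 L)› = LinearOrder.toDecidableEq := Subsingleton.elim _ _
  letI instDE' : DecidableEq (FermionTorus 2 L) := LinearOrder.toDecidableEq
  rw [fermionEmbed_fermionEmbed]
  exact commute_of_mem_carEvenSubalgebra
    (magneticHubbardTorus_windowGauge_sub_hubbardTorus_mem hL U θ hΛ hclosed hInj')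
    (fermionEmbed_mem_carSubalgebra _ B) disjoint_compl_left

/-- **EOM rows transport to the flux torus.** In the uniform gauge, the commutator of `H_u` with the
gauge-twisted image of a window observable of `Λ` is the gauge-twisted image of the window commutator:
`[H_u, W_ĝ Γ(ι) B W_ĝᴴ] = W_ĝ Γ(ι)([h_{Λ'}, B]) W_ĝᴴ`. (Lieb 1994 gauge covariance + the sharp periodic
commutator lemma of pub-mbboot + locality of the non-image defect.) -/
theorem magneticHubbardTorus_commutator_gaugeAut_fermionEmbed [DecidableEq (FermionTorus 2 L)] (hL : 3 ≤ L) (U θ : ℝ)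
    {Λ Λ' : Finset (Site 2)} (hΛ : Λ ⊆ Λ')
    (hclosed : ∀ x ∈ Λ, ∀ i : Fin 2, x + unitVec i ∈ Λ' ∧ x - unitVec i ∈ Λ')
    (hInj' : Set.InjOn (Torus.proj (d := 2) L) ↑Λ') (B : FermionOp Λ) :
    magneticHubbardTorus L (uniformTwistConfig L θ) 1 U *
          gaugeAut (fun u : FermionTorus 2 L => windowTwist L θ Λ' u.toTorusSite)
            (fermionEmbed (PolySite.toTorusEmb L hInj') (fermionEmbed (PolySite.incl hΛ) B)) -
        gaugeAut (fun u : FermionTorus 2 L => windowTwist L θ Λ' u.toTorusSite)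
            (fermionEmbed (PolySite.toTorusEmb L hInj') (fermionEmbed (PolySite.incl hΛ) B)) *
          magneticHubbardTorus L (uniformTwistConfig L θ) 1 U =
      gaugeAut (fun u : FermionTorus 2 L => windowTwist L θ Λ' u.toTorusSite)
        (fermionEmbed (PolySite.toTorusEmb L hInj')
          ((hubbardFermionInteraction 2 1 U).localHamiltonian Λ' * fermionEmbed (PolySite.incl hΛ) B -
            fermionEmbed (PolySite.incl hΛ) B * (hubbardFermionInteraction 2 1 U).localHamiltonian Λ')) := by
  obtain rfl : ‹DecidableEq (FermionTorus 2 L)› = LinearOrder.toDecidableEq := Subsingleton.elim _ _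
  letI instDE' : DecidableEq (FermionTorus 2 L) := LinearOrder.toDecidableEq
  set ĝ : FermionTorus 2 L → Circle := fun u => windowTwist L θ Λ' u.toTorusSite with hĝ
  set H' := magneticHubbardTorus L (gaugeTransform (windowTwist L θ Λ') (uniformTwistConfig L θ)) 1 U
    with hH'
  set Z := fermionEmbed (PolySite.toTorusEmb L hInj') (fermionEmbed (PolySite.incl hΛ) B) with hZ
  -- `H_u = W_ĝ H' W_ĝᴴ`
  have hgauge : magneticHubbardTorus L (uniformTwistConfig L θ) 1 U = gaugeAut ĝ H' := by
    rw [gaugeAut_apply, hH', magneticHubbardTorus_gaugeTransform]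
    simp only [← Matrix.mul_assoc]
    rw [phaseGauge_mul_conjTranspose_self, Matrix.one_mul, Matrix.mul_assoc,
      phaseGauge_mul_conjTranspose_self, Matrix.mul_one]
  -- the non-image defect commutes with the window observable
  have hcomm : (H' - hubbardTorus 2 L 1 U) * Z = Z * (H' - hubbardTorus 2 L 1 U) :=
    (commute_windowGaugeDefect_fermionEmbed hL U θ hΛ hclosed hInj' B).eq
  have hsharp := Summit.HubbardSuperconductivity.ManyBodyBootstrap.hubbardTorus_commutator_fermionEmbed_sharp
    L 1 U hΛ hclosed hInj' B
  rw [← hZ] at hsharp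
  rw [hgauge, ← map_mul (gaugeAut ĝ), ← map_mul (gaugeAut ĝ), ← map_sub (gaugeAut ĝ), ← hsharp]
  congr 1
  have e : H' = hubbardTorus 2 L 1 U + (H' - hubbardTorus 2 L 1 U) := by abel
  rw [e, Matrix.add_mul, Matrix.mul_add, hcomm]
  abel

/-- **Translation rows transport to the flux torus**: the gauge-twisted image of a window translation
difference `Γ(incl)(τ_v Y) − Γ(incl) Y` is a symmetry defect `U Yₜ Uᴴ − Yₜ` for the symmetry
`U = T_{v mod L} · e^{iθ v₁ N̂ / L}` of `H_u`. -/
theorem gaugeAut_fermionEmbed_shift_sub [DecidableEq (FermionTorus 2 L)] (θ : ℝ) {Λ Λ' : Finset (Site 2)} (hΛ : Λ ⊆ Λ') (v : Site 2)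
    (hsh : shiftSet v Λ ⊆ Λ') (hInj' : Set.InjOn (Torus.proj (d := 2) L) ↑Λ') (Y : FermionOp Λ) :
    gaugeAut (fun u : FermionTorus 2 L => windowTwist L θ Λ' u.toTorusSite)
        (fermionEmbed (PolySite.toTorusEmb L hInj')
          (fermionEmbed (PolySite.incl hsh) (fermionEmbed (PolySite.shiftEmb v Λ) Y) -
            fermionEmbed (PolySite.incl hΛ) Y)) =
      ((fockTranslate (Torus.proj L v)).val *
            phaseGauge (fun _ : FermionTorus 2 L => Circle.exp (θ / L * (v 0 : ℝ)))) *
          gaugeAut (fun u : FermionTorus 2 L => windowTwist L θ Λ' u.toTorusSite)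
            (fermionEmbed (PolySite.toTorusEmb L (hInj'.mono (by exact_mod_cast hΛ))) Y) *
          ((fockTranslate (Torus.proj L v)).val *
            phaseGauge (fun _ : FermionTorus 2 L => Circle.exp (θ / L * (v 0 : ℝ))))ᴴ -
        gaugeAut (fun u : FermionTorus 2 L => windowTwist L θ Λ' u.toTorusSite)
          (fermionEmbed (PolySite.toTorusEmb L (hInj'.mono (by exact_mod_cast hΛ))) Y) := by
  obtain rfl : ‹DecidableEq (FermionTorus 2 L)› = LinearOrder.toDecidableEq := Subsingleton.elim _ _
  letI instDE' : DecidableEq (FermionTorus 2 L) := LinearOrder.toDecidableEq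
  set ĝ : FermionTorus 2 L → Circle := fun u => windowTwist L θ Λ' u.toTorusSite with hĝ
  set c : Circle := Circle.exp (θ / L * (v 0 : ℝ)) with hc
  have hInjΛ : Set.InjOn (Torus.proj (d := 2) L) ↑Λ := hInj'.mono (by exact_mod_cast hΛ)
  have hInjS : Set.InjOn (Torus.proj (d := 2) L) ↑(shiftSet v Λ) := hInj'.mono (by exact_mod_cast hsh)
  -- the window gauge on `Λ + v` is the window gauge on `Λ` times the constant `c`
  have hfun : (ĝ ∘ ⇑(PolySite.toTorusEmb L hInjS)) ∘ ⇑(PolySite.shiftEmb v Λ) =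
      (fun _ => c) * (ĝ ∘ ⇑(PolySite.toTorusEmb L hInjΛ)) := by
    funext y
    simp only [Function.comp_apply, Pi.mul_apply, hĝ]
    rw [windowTwist_toTorusEmb θ hsh hInj', windowTwist_toTorusEmb θ hΛ hInj', hc, ← Circle.exp_add,
      PolySite.ofLex_coe_shiftEmb, Pi.add_apply, Int.cast_add]
    congr 1
    ring
  rw [map_sub, fermionEmbed_toTorusEmb_incl hsh hInj', fermionEmbed_toTorusEmb_incl hΛ hInj',
    map_sub, gaugeAut_fermionEmbed ĝ (PolySite.toTorusEmb L hInjS), gaugeAut_fermionEmbed, hfun,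
    gaugeAut_mul_apply, fermionEmbed_toTorusEmb_shiftEmb L v hInjΛ hInjS, relabel_eq_fockRelabel_conj]
  have hconst : fermionEmbed (PolySite.toTorusEmb L hInjΛ)
      (gaugeAut (fun _ : PolySite Λ => c) (gaugeAut (ĝ ∘ ⇑(PolySite.toTorusEmb L hInjΛ)) Y)) =
      gaugeAut (fun _ : FermionTorus 2 L => c)
        (gaugeAut ĝ (fermionEmbed (PolySite.toTorusEmb L hInjΛ) Y)) := by
    rw [gaugeAut_fermionEmbed ĝ, gaugeAut_fermionEmbed (fun _ : FermionTorus 2 L => c)]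
    rfl
  rw [hconst, gaugeAut_apply (fun _ : FermionTorus 2 L => c), conjTranspose_mul]
  simp only [Matrix.mul_assoc]

end Window

end Summit.Ventures.CertifiedManyBodySolver.Rows
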